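/-
Copyright (c) 2026 the pub-hodgecm-mathlib formalisation cell (harness21).  Prover seat hodgecm-mathlib-K2E3-p17 (g6), Track B «K2-LIT» ∕ h413
(`stmt-HodgeConjecture-24833`), line `K2_E3_EllipticInputs`, unit U12 §L, Richardson road for (LBGL-ge3) at `N = 3` (road owner K2E3-p11),
brick (F-J) = (S-B♭)_Lie, FILE I «`Ad(GL₃(F))`-INVARIANCE OF THE ADDITIVE HAAR MEASURE OF `𝔤𝔩₃(F)`».  2026-09-04.
-/
import Summits.HodgeConjecture.HodgeConjecture.Theorems.K2E3GL3RegularDiagonalOrbitChart  -- ★ p857634 (this seat, E2): `addEquivAddHaarChar_scaling`; brings ★ `regular_of_isAddHaarMeasure`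
import Summits.HodgeConjecture.HodgeConjecture.Theorems.K2E3GLnLieAdIntegralInvariant     -- ★ (K2E3-p12): `lintegral_comp_conj_of_mem_glInt` (`Ad(K)`-invariance)
import Literature.MeasureTheory.Group.LocalFieldLinearJacobian                           -- ★ `map_eq_addEquivAddHaarChar_inv_smul`
import Mathlib.LinearAlgebra.Matrix.Transvection
import HarnessLib

/-!
# K2_E3 road (h413), §L ∕ Richardson road at `N = 3`, brick (F-J) FILE I: `∫⁻ h(g X g⁻¹) dμ𝔤(X) = ∫⁻ h dμ𝔤` for EVERY `g ∈ GL₃(F)`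

Cell `pub/hodgecm-mathlib` (D-0151), Track B, seat K2E3-p17 (g6), deal (D60) = (F-J) (road owner K2E3-p11).  `--supports stmt-HodgeConjecture-24833 --as helper`;
THEOREMS ONLY (no definition ∕ instance ∕ notation ∕ named fact ∕ `sorry`); never imports `Cruxes/…/Lines`.  COUNT-NEUTRAL.

THE RESULT (**`lintegral_comp_conj_eq`**): an additive Haar measure `μ𝔤` on `𝔤𝔩₃(F)` (`F` a non-archimedean local field) is invariant under `Ad(g) : X ↦ g X g⁻¹`
for every `g ∈ GL₃(F)` — `|det Ad(g)|_F = |det g|³·|det g|⁻³ = 1`.  The tree had this for `g ∈ K = GL₃(𝒪)` (★ `K2E3GLnLieAdIntegralInvariant`); brick H of (F-J)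
moves orbit charts to every split regular semisimple point by `Ad(G)`, so it needs all of `G`.
PROOF (no determinant is computed).  Mathlib's `Matrix.diagonal_transvection_induction_of_det_ne_zero`: it suffices to treat diagonal `g` — an entrywise
scaling `X_{ij} ↦ (D_i∕D_j) X_{ij}` whose Haar character is `‖∏_{ij} D_i∕D_j‖ = ‖1‖ = 1` (★ E2 `addEquivAddHaarChar_scaling`) — and transvections
`T_{ij}(c) = a · T_{ij}(1) · a′` with `a = diag(1,…,c⁻¹@j,…)`, `a′ = a⁻¹` diagonal and `T_{ij}(1) ∈ SL₃(ℤ) ⊆ K` (★ `Ad(K)`-invariance); products are formal.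
[WeilBNT1967, Ch. I §2 Cor. 3 of Thm. 3 (`mod` of an automorphism); HarishChandra1970, Part I §1]
HONEST LABEL: HC_CM is proved only modulo the 7 printed citations (2 remaining named inputs: hLiu418 = stmt-HodgeConjecture-24832, h413 = stmt-HodgeConjecture-24833)
until rung 0 closes; count-neutral helper.

## References
* [WeilBNT1967] A. Weil, *Basic Number Theory* (1967), Ch. I §2 (the module of an automorphism; Cor. 3 of Thm. 3).
* [HarishChandra1970] Harish-Chandra (notes by G. van Dijk), *Harmonic Analysis on Reductive p-adic Groups*, LNM 162 (1970), Part I §1.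
-/

set_option autoImplicit false
set_option linter.dupNamespace false

noncomputable section

open MeasureTheory Measure Filter Topology Set Matrix ValuativeRel
open scoped MatrixGroups NNReal ENNReal Valued
open Literature.NumberTheory.Automorphic Literature.NumberTheory.Automorphic.LocalFieldHaar
open Literature.NumberTheory.GaloisRepresentations Literature.NumberTheory.GaloisRepresentations.IsNonarchimedeanLocalField
open Summit.HodgeConjecture.HodgeConjecture.Cruxes.H413.K2E3GL3RegularDiagonalOrbitChart

namespace Summit.HodgeConjecture.HodgeConjecture.Cruxes.H413.K2E3GL3LieAdInvariant

/-! ## §1  Pure algebra: a transvection is a diagonal conjugate of an INTEGRAL transvection -/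

section Algebra

variable {R : Type*} [Field R]

/-- `T_{ij}(c) = diag(a) · T_{ij}(1) · diag(a′)` with `a = 1` except `a_j = c⁻¹`, `a′ = 1` except `a′_j = c` (`c ≠ 0`, `i ≠ j`). [folklore] -/
theorem transvection_eq_diagonal_mul_transvection_one_mul_diagonal {i j : Fin 3} (hij : i ≠ j) {c : R} (hc : c ≠ 0) :
    Matrix.transvection i j c =
      Matrix.diagonal (Function.update (1 : Fin 3 → R) j c⁻¹) * Matrix.transvection i j 1 * Matrix.diagonal (Function.update (1 : Fin 3 → R) j c) := by
  ext k l
  simp only [Matrix.transvection, Matrix.mul_diagonal, Matrix.diagonal_mul, Matrix.add_apply, Matrix.one_apply, Matrix.single_apply,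
    Function.update_apply, Pi.one_apply]
  by_cases hkl : k = l
  · subst hkl
    have hk : ¬(i = k ∧ j = k) := fun h => hij (h.1.trans h.2.symm)
    by_cases hkj : k = j
    · simp [hkj, hc, hij]
    · simp [hk, hkj]
  · by_cases h2 : i = k ∧ j = l
    · obtain ⟨rfl, rfl⟩ := h2
      simp [hkl]
    · simp [hkl, h2]

/-- `diag(a) · diag(a′) = 1` for the pair of §1. [folklore] -/
theorem diagonal_update_mul_diagonal_update (j : Fin 3) {c : R} (hc : c ≠ 0) :
    Matrix.diagonal (Function.update (1 : Fin 3 → R) j c⁻¹) * Matrix.diagonal (Function.update (1 : Fin 3 → R) j c) = 1 := by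
  rw [Matrix.diagonal_mul_diagonal, ← Matrix.diagonal_one]
  congr 1
  funext k
  simp only [Function.update_apply, Pi.one_apply]
  split_ifs with h
  · exact inv_mul_cancel₀ hc
  · exact mul_one _

/-- Entries of `T_{ij}(c)` lie in `{0, 1, c, 1 + c}` — here: in any subring containing `c`. [folklore] -/
theorem transvection_apply_mem {S : Type*} [SetLike S R] [SubringClass S R] (s : S) (i j : Fin 3) {c : R} (hc : c ∈ s) (k l : Fin 3) :
    Matrix.transvection i j c k l ∈ s := by
  simp only [Matrix.transvection, Matrix.add_apply, Matrix.one_apply, Matrix.single_apply]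
  split_ifs
  · exact add_mem (one_mem s) hc
  · exact add_mem (one_mem s) (zero_mem s)
  · exact add_mem (zero_mem s) hc
  · exact add_mem (zero_mem s) (zero_mem s)

end Algebra

/-! ## §2  The invariance -/

section Invariance

variable {F : Type*} [Field F] [ValuativeRel F] [TopologicalSpace F] [IsNonarchimedeanLocalField F]
  [MeasurableSpace F] [BorelSpace F]
  [MeasurableSpace (Matrix (Fin 3) (Fin 3) F)] [BorelSpace (Matrix (Fin 3) (Fin 3) F)]

omit [MeasurableSpace F] [BorelSpace F] [MeasurableSpace (Matrix (Fin 3) (Fin 3) F)] [BorelSpace (Matrix (Fin 3) (Fin 3) F)] in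
/-- `X ↦ M X M⁻¹` (`det M ≠ 0`) is a continuous linear automorphism of `M₃(F)`. [folklore] -/
theorem exists_continuousLinearEquiv_conj (M : Matrix (Fin 3) (Fin 3) F) (hM : IsUnit M.det) :
    ∃ e : Matrix (Fin 3) (Fin 3) F ≃L[F] Matrix (Fin 3) (Fin 3) F, ∀ X, e X = M * X * M⁻¹ := by
  haveI : IsTopologicalRing F := inferInstance
  refine ⟨ContinuousLinearEquiv.mk
    { toFun := fun X => M * X * M⁻¹
      invFun := fun X => M⁻¹ * X * M
      map_add' := fun X Y => by rw [Matrix.mul_add, Matrix.add_mul]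
      map_smul' := fun a X => by rw [Matrix.mul_smul, Matrix.smul_mul, RingHom.id_apply]
      left_inv := fun X => by
        show M⁻¹ * (M * X * M⁻¹) * M = X
        rw [← Matrix.mul_assoc, ← Matrix.mul_assoc, Matrix.nonsing_inv_mul _ hM, Matrix.one_mul, Matrix.nonsing_inv_mul_cancel_right _ _ hM]
      right_inv := fun X => by
        show M * (M⁻¹ * X * M) * M⁻¹ = X
        rw [← Matrix.mul_assoc, ← Matrix.mul_assoc, Matrix.mul_nonsing_inv _ hM, Matrix.one_mul, Matrix.mul_nonsing_inv_cancel_right _ _ hM] }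
    ((continuous_const.mul continuous_id).mul continuous_const) ((continuous_const.mul continuous_id).mul continuous_const), fun X => rfl⟩

omit [ValuativeRel F] [TopologicalSpace F] [IsNonarchimedeanLocalField F] [MeasurableSpace F] [BorelSpace F] [BorelSpace (Matrix (Fin 3) (Fin 3) F)] in
/-- **Products**: if `Ad(A)` and `Ad(B)` preserve `∫⁻ · dμ𝔤` then so does `Ad(AB)`. [folklore] -/
theorem forall_lintegral_comp_conj_mul (μ𝔤 : Measure (Matrix (Fin 3) (Fin 3) F)) {A B : Matrix (Fin 3) (Fin 3) F}
    (hA : ∀ h : Matrix (Fin 3) (Fin 3) F → ℝ≥0∞, ∫⁻ X, h (A * X * A⁻¹) ∂μ𝔤 = ∫⁻ X, h X ∂μ𝔤)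
    (hB : ∀ h : Matrix (Fin 3) (Fin 3) F → ℝ≥0∞, ∫⁻ X, h (B * X * B⁻¹) ∂μ𝔤 = ∫⁻ X, h X ∂μ𝔤)
    (h : Matrix (Fin 3) (Fin 3) F → ℝ≥0∞) : ∫⁻ X, h (A * B * X * (A * B)⁻¹) ∂μ𝔤 = ∫⁻ X, h X ∂μ𝔤 := by
  have h1 : ∀ X, A * B * X * (A * B)⁻¹ = A * (B * X * B⁻¹) * A⁻¹ := fun X => by
    rw [Matrix.mul_inv_rev]; simp only [Matrix.mul_assoc]
  simp_rw [h1]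
  rw [hB (fun Y => h (A * Y * A⁻¹)), hA h]

/-- **Diagonal `g`**: `∫⁻ h(D X D⁻¹) dμ𝔤 = ∫⁻ h dμ𝔤` for `D = diag(D_i)`, `D_i ≠ 0` (entrywise scaling by `D_i∕D_j`, Haar character `‖∏ D_i∕D_j‖ = 1`).
[cite: WeilBNT1967, Ch. I §2, Cor. 3 of Thm. 3] -/
theorem lintegral_comp_conj_diagonal (μ𝔤 : Measure (Matrix (Fin 3) (Fin 3) F)) [μ𝔤.IsAddHaarMeasure] (D : Fin 3 → F) (hD : ∀ i, D i ≠ 0)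
    (h : Matrix (Fin 3) (Fin 3) F → ℝ≥0∞) :
    ∫⁻ X, h (Matrix.diagonal D * X * (Matrix.diagonal D)⁻¹) ∂μ𝔤 = ∫⁻ X, h X ∂μ𝔤 := by
  classical
  haveI : T2Space F := (isLocalField F).toT2Space
  haveI : LocallyCompactSpace F := (isLocalField F).toLocallyCompactSpace
  haveI : SecondCountableTopology F := secondCountableTopology_localField F
  haveI : IsTopologicalRing F := inferInstance
  haveI : LocallyCompactSpace (Matrix (Fin 3) (Fin 3) F) := Pi.locallyCompactSpace_of_finite
  haveI : μ𝔤.Regular := K2E3GLnMaximalParabolicDescent.regular_of_isAddHaarMeasure (F := F) μ𝔤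
  have hdet : IsUnit (Matrix.diagonal D).det := by
    rw [Matrix.det_diagonal, isUnit_iff_ne_zero]; exact Finset.prod_ne_zero_iff.2 fun i _ => hD i
  have hinv : (Matrix.diagonal D)⁻¹ = Matrix.diagonal fun i => (D i)⁻¹ := by
    refine Matrix.inv_eq_right_inv ?_
    rw [Matrix.diagonal_mul_diagonal, ← Matrix.diagonal_one]
    congr 1; funext i; exact mul_inv_cancel₀ (hD i)
  obtain ⟨e, he⟩ := exists_continuousLinearEquiv_conj (Matrix.diagonal D) hdet
  have he' : ∀ X i j, e X i j = (D i * (D j)⁻¹) * X i j := fun X i j => by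
    rw [he, hinv, Matrix.mul_diagonal, Matrix.diagonal_mul]; ring
  have hchar : MeasureTheory.addEquivAddHaarChar e.toContinuousAddEquiv = 1 := by
    rw [addEquivAddHaarChar_scaling (fun i j => D i * (D j)⁻¹) (fun i j => mul_ne_zero (hD i) (inv_ne_zero (hD j))) e he']
    have hP : ∏ i : Fin 3, D i ≠ 0 := Finset.prod_ne_zero_iff.2 fun i _ => hD i
    have : (∏ i : Fin 3, ∏ j : Fin 3, D i * (D j)⁻¹) = 1 := by
      simp only [Finset.prod_mul_distrib, Finset.prod_const, Finset.card_univ, Fintype.card_fin, Finset.prod_inv_distrib, Finset.prod_pow]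
      rw [← mul_pow, mul_inv_cancel₀ hP, one_pow]
    rw [this, map_one]
  have hmap : μ𝔤.map e = μ𝔤 := by
    have h0 := Literature.MeasureTheory.Group.map_eq_addEquivAddHaarChar_inv_smul μ𝔤 e.toContinuousAddEquiv
    rw [hchar, inv_one, one_smul] at h0
    exact h0
  have h1 := lintegral_map_equiv (μ := μ𝔤) h e.toHomeomorph.toMeasurableEquiv
  simp only [Homeomorph.toMeasurableEquiv_coe, ContinuousLinearEquiv.coe_toHomeomorph] at h1
  rw [hmap] at h1
  rw [h1]
  exact lintegral_congr fun X => by rw [he]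

omit [MeasurableSpace F] [BorelSpace F] in
/-- **The integral transvection `T_{ij}(1)` lies in `K = GL₃(𝒪)`**, so `Ad(T_{ij}(1))` preserves `μ𝔤`. [cite: WeilBNT1967, Ch. I §2, Cor. 2 of Thm. 3] -/
theorem lintegral_comp_conj_transvection_one (μ𝔤 : Measure (Matrix (Fin 3) (Fin 3) F)) [μ𝔤.IsAddHaarMeasure] {i j : Fin 3} (hij : i ≠ j)
    (h : Matrix (Fin 3) (Fin 3) F → ℝ≥0∞) :
    ∫⁻ X, h (Matrix.transvection i j (1 : F) * X * (Matrix.transvection i j (1 : F))⁻¹) ∂μ𝔤 = ∫⁻ X, h X ∂μ𝔤 := by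
  have hmul : Matrix.transvection i j (1 : F) * Matrix.transvection i j (-1 : F) = 1 := by
    rw [Matrix.transvection_mul_transvection_same i j hij, add_neg_cancel, Matrix.transvection_zero]
  have hmul' : Matrix.transvection i j (-1 : F) * Matrix.transvection i j (1 : F) = 1 := by
    rw [Matrix.transvection_mul_transvection_same i j hij, neg_add_cancel, Matrix.transvection_zero]
  set k : GL (Fin 3) F := ⟨Matrix.transvection i j 1, Matrix.transvection i j (-1), hmul, hmul'⟩ with hk
  have hkK : k ∈ glInt 3 F := by
    rw [mem_glInt_iff]
    refine ⟨fun a b => ?_, fun a b => ?_⟩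
    · exact transvection_apply_mem (𝒪[F]) i j (one_mem _) a b
    · show Matrix.transvection i j (-1 : F) a b ∈ 𝒪[F]
      exact transvection_apply_mem (𝒪[F]) i j (neg_mem (one_mem _)) a b
  have h0 := K2E3GLnLieAdIntegralInvariant.lintegral_comp_conj_of_mem_glInt μ𝔤 hkK h
  have hinv : (Matrix.transvection i j (1 : F))⁻¹ = Matrix.transvection i j (-1) := Matrix.inv_eq_right_inv hmul
  rw [hinv]
  exact h0

/-- **`Ad(G)`-INVARIANCE OF `μ𝔤` (matrix form)**: `∫⁻ h(M X M⁻¹) dμ𝔤 = ∫⁻ h dμ𝔤` for every `M` with `det M ≠ 0` and every `h ≥ 0`.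
[cite: WeilBNT1967, Ch. I §2, Cor. 3 of Thm. 3] [cite: HarishChandra1970, Part I §1] -/
theorem lintegral_comp_conj_eq_of_det_ne_zero (μ𝔤 : Measure (Matrix (Fin 3) (Fin 3) F)) [μ𝔤.IsAddHaarMeasure]
    (M : Matrix (Fin 3) (Fin 3) F) (hM : M.det ≠ 0) (h : Matrix (Fin 3) (Fin 3) F → ℝ≥0∞) :
    ∫⁻ X, h (M * X * M⁻¹) ∂μ𝔤 = ∫⁻ X, h X ∂μ𝔤 := by
  classical
  revert h
  refine Matrix.diagonal_transvection_induction_of_det_ne_zero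
    (fun M : Matrix (Fin 3) (Fin 3) F => ∀ h : Matrix (Fin 3) (Fin 3) F → ℝ≥0∞, ∫⁻ X, h (M * X * M⁻¹) ∂μ𝔤 = ∫⁻ X, h X ∂μ𝔤)
    M hM (fun D hD h => ?_) (fun t h => ?_) (fun A B _ _ hA hB h => forall_lintegral_comp_conj_mul μ𝔤 hA hB h)
  · rw [Matrix.det_diagonal] at hD
    exact lintegral_comp_conj_diagonal μ𝔤 D (fun i hi => hD (Finset.prod_eq_zero (Finset.mem_univ i) hi)) h
  · obtain ⟨i, j, hij, c⟩ := t
    rw [Matrix.TransvectionStruct.toMatrix_mk]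
    by_cases hc : c = 0
    · subst hc
      simp only [Matrix.transvection_zero, Matrix.one_mul, inv_one, Matrix.mul_one]
    rw [transvection_eq_diagonal_mul_transvection_one_mul_diagonal hij hc]
    refine forall_lintegral_comp_conj_mul μ𝔤 (forall_lintegral_comp_conj_mul μ𝔤 ?_ ?_) ?_ h
    · refine lintegral_comp_conj_diagonal μ𝔤 _ (fun l => ?_)
      rw [Function.update_apply]; split_ifs
      · exact inv_ne_zero hc
      · exact one_ne_zero
    · exact lintegral_comp_conj_transvection_one μ𝔤 hij
    · refine lintegral_comp_conj_diagonal μ𝔤 _ (fun l => ?_)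
      rw [Function.update_apply]; split_ifs
      · exact hc
      · exact one_ne_zero

/-- **`Ad(G)`-INVARIANCE OF `μ𝔤`**: `∫⁻ h(g X g⁻¹) dμ𝔤(X) = ∫⁻ h dμ𝔤` for every `g ∈ GL₃(F)` and every `h ≥ 0`.
[cite: WeilBNT1967, Ch. I §2, Cor. 3 of Thm. 3] [cite: HarishChandra1970, Part I §1] -/
theorem lintegral_comp_conj_eq (μ𝔤 : Measure (Matrix (Fin 3) (Fin 3) F)) [μ𝔤.IsAddHaarMeasure] (g : GL (Fin 3) F)
    (h : Matrix (Fin 3) (Fin 3) F → ℝ≥0∞) :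
    ∫⁻ X, h ((g : Matrix (Fin 3) (Fin 3) F) * X * ((g⁻¹ : GL (Fin 3) F) : Matrix (Fin 3) (Fin 3) F)) ∂μ𝔤 = ∫⁻ X, h X ∂μ𝔤 := by
  have hdet : (g : Matrix (Fin 3) (Fin 3) F).det ≠ 0 := (Matrix.isUnits_det_units g).ne_zero
  simp_rw [Matrix.coe_units_inv]
  exact lintegral_comp_conj_eq_of_det_ne_zero μ𝔤 _ hdet h

/-- … and the set-integral form over an `Ad(g)`-translate: `∫⁻_{X ∈ Ad(g)⁻¹ S} h(g X g⁻¹) dμ𝔤 = ∫⁻_{S} h dμ𝔤`, written with indicators.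
[cite: WeilBNT1967, Ch. I §2, Cor. 3 of Thm. 3] -/
theorem lintegral_indicator_comp_conj_eq (μ𝔤 : Measure (Matrix (Fin 3) (Fin 3) F)) [μ𝔤.IsAddHaarMeasure] (g : GL (Fin 3) F)
    (S : Set (Matrix (Fin 3) (Fin 3) F)) (h : Matrix (Fin 3) (Fin 3) F → ℝ≥0∞) :
    ∫⁻ X, S.indicator h ((g : Matrix (Fin 3) (Fin 3) F) * X * ((g⁻¹ : GL (Fin 3) F) : Matrix (Fin 3) (Fin 3) F)) ∂μ𝔤 = ∫⁻ X, S.indicator h X ∂μ𝔤 :=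
  lintegral_comp_conj_eq μ𝔤 g (S.indicator h)

end Invariance

end Summit.HodgeConjecture.HodgeConjecture.Cruxes.H413.K2E3GL3LieAdInvariant

end
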